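import Summits.Ventures.CertifiedManyBodySolver.Upper.StripCellHamiltonian
import Summits.Ventures.CertifiedManyBodySolver.Upper.StripCellsDiag
import Summits.Ventures.CertifiedManyBodySolver.Upper.StripCellWordsDiag

/-!
# The open Hubbard strip in column-major order, III′: the blocked `t–t′` Hamiltonian and the cell bond matrix
# `stripCellBondMatrixTT'`

HONEST FRAMING: first certified bounds; not a superconductivity verdict; every number certified or
labelled float. NO NUMBER IS CLAIMED HERE (producer-free operator identities and two definitions).

Venture `Ventures/CertifiedManyBodySolver` (sr-mbsolver), the `t′`-general strip-cell transport theorem (VAR item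
V13), PART 3/5 (parts 1–2: `Upper/StripCellsDiag.lean`, `Upper/StripCellWordsDiag.lean`; the `t′ = 0` original:
`Upper/StripCellHamiltonian.lean`). The open-cluster `t–t′` Hamiltonian is
`hubbardOpenBoxTT' a b t t' U = hamiltonian (rectBoxGraph a b) t U + hamiltonian (rectBoxDiagGraph a b) t' 0`
(LeBlanc et al. (2015) eq. (1)): the `t′` term is ONE MORE hopping sum, on the diagonal graph. Blocking the
`(C·c) × W` column-major box into `C` cells of `c` columns (any enumeration `κ` of the cell configurations):

* `adjRowPairs W` — the ordered pairs of chain-adjacent rows `(y₀, y₁)` (the inter-cell diagonal bonds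
  `((c-1, y₀) of b) — ((0, y₁) of b+1)`), `sum_adjRowPairs_eq`;
* `toSpin_hubbardOpenBoxTT'_eq_add_diag` — `toSpin H(t,t′,U) = toSpin H(t,0,U) − t′·(diagonal hopping words)`;
* `superOp_hoppingSum_diag` — the diagonal hopping words of the big box, blocked (cell words + two-row inter-cell
  words of part II′);
* **`superOp_toSpin_hubbardOpenBoxTT'_TT'`** — `superOp (toSpin H_open((C·c) × W; t, t′, U)) =
  Σ_b onSite b (superSite κ (toSpin H_open(c × W; t, t′, U))) − t Σ_{b+1=b'} Σ_{y₀,σ} (L_b R_{b'} + L'_b R'_{b'})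
  − t′ Σ_{b+1=b'} Σ_{(y₀,y₁) adjacent, σ} (L_{y₀,b} R_{y₁,b'} + L'_{y₀,b} R'_{y₁,b'})`;
* `interCellDiagMatrix κ hc t'`, **`stripCellBondMatrixTT' κ hc t t' U = superSite κ (toSpin H_open(c × W; t,t′,U)) ⊗ 1
  + interCellMatrix κ hc t + interCellDiagMatrix κ hc t'`** — the cell bond matrix `hh` of the `t–t′` strip (intra-cell
  energy of the LEFT cell incl. its diagonals + horizontal coupling + diagonal coupling); `interCellDiagMatrix_tPrime_zero`,
  `stripCellBondMatrixTT'_tPrime_zero` (at `t′ = 0` it is `stripCellBondMatrix κ hc t U` on the nose);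
  `bondSum_zero`, `bondSum_interCellDiagMatrix`;
* **`superOp_toSpin_hubbardOpenBoxTT'_eq_bondSum_TT'`** — on `n + 2` cells:
  `superOp (toSpin H(t,t′,U)) = bondSum n (stripCellBondMatrixTT' κ hc t t' U) + onSite (last cell) (superSite κ (toSpin H_cell(t,t′,U)))`.

This is the presentation the uMPS tensor side (`Upper/UMPSDualBound.lean`) consumes, exactly as at `t′ = 0`; eng-1's
`bd-strip-cell-v1` certificates at `t′ ≠ 0` are written against this `hh` (their term list includes the cell's diagonal
bonds and the `2(W−1)` inter-cell diagonal bonds). Parts 4–5: `Upper/StripCellStructureTTPrime.lean`,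
`Theorems/R2cStripCellTTPrimeEnergyDensity.lean`. References: LeBlanc et al., PRX 5 (2015) 041041, eq. (1)
[LeBlancEtAl2015]; Essler et al. (2005) §12.3.4 [EsslerEtAl2005].
-/

noncomputable section

open Matrix Finset
open scoped ComplexOrder BigOperators Kronecker

namespace Summit.Ventures.CertifiedManyBodySolver.Upper

open Literature.MathematicalPhysics.QuantumLattice
open Literature.MathematicalPhysics.QuantumLattice.JordanWigner

/-! ### The adjacent row pairs -/

section AdjRows

variable {W : ℕ}

variable (W) in
/-- The ordered pairs `(y₀, y₁)` of chain-adjacent rows, `|y₀ − y₁| = 1`, of a column of height `W` — the index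
set of the DIAGONAL bonds between two consecutive columns (row `y₀` on the left column, row `y₁` on the right). -/
def adjRowPairs : Finset (Fin W × Fin W) :=
  Finset.univ.filter fun d => lineAdj (d.1 : ℕ) d.2

/-- Membership in `adjRowPairs`. -/
@[simp] theorem mem_adjRowPairs (d : Fin W × Fin W) : d ∈ adjRowPairs W ↔ lineAdj (d.1 : ℕ) d.2 := by
  simp [adjRowPairs]

/-- A sum over the adjacent row pairs is the double row sum with the adjacency indicator. -/
theorem sum_adjRowPairs_eq {M : Type*} [AddCommMonoid M] (G : Fin W × Fin W → M) :
    ∑ d ∈ adjRowPairs W, G d = ∑ y₀ : Fin W, ∑ y₁ : Fin W, if lineAdj (y₀ : ℕ) y₁ then G (y₀, y₁) else 0 := by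
  rw [adjRowPairs, Finset.sum_filter, Fintype.sum_prod_type]

end AdjRows

/-! ### The blocked `t–t′` Hamiltonian -/

section Hamiltonian

variable {C c W Q : ℕ}

/-- **The `t′` term is one more hopping sum**: `toSpin H_open(a × b; t, t′, U) = toSpin H_open(a × b; t, 0, U)
− t′ Σ_{p,q,σ} [p, q diagonal neighbours] c†_{pσ} F⋯F c_{qσ}` (the diagonal graph carries no on-site term). -/
theorem toSpin_hubbardOpenBoxTT'_eq_add_diag (a b : ℕ) (t t' U : ℝ) :
    toSpin (hubbardOpenBoxTT' a b t t' U) = toSpin (hubbardOpenBoxTT' a b t 0 U) +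
      (-(t' : ℂ)) • ∑ p : Fin a ×ₗ Fin b, ∑ q : Fin a ×ₗ Fin b, ∑ σ : Fin 2,
        if (rectBoxDiagGraph a b).Adj p q then
          onSite p (siteCreation σ) * (jwString p * jwString q) * onSite q (siteAnnihilation σ) else 0 := by
  rw [hubbardOpenBoxTT', hubbardOpenBoxTT'_tPrime_zero, map_add, toSpin_hamiltonian (rectBoxDiagGraph a b) t' 0,
    Complex.ofReal_zero, zero_smul, add_zero]

/-- **The diagonal hopping words of the `(C·c) × W` box, blocked**: the words of the diagonal bonds inside a cell
block to that cell's own diagonal hopping words (as a one-cell operator), the words of the diagonal bonds between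
consecutive cells to the products of the two-row inter-cell half-words. -/
theorem superOp_hoppingSum_diag (hc : 0 < c) (κ : TensorIndex (Fin c ×ₗ Fin W) 4 ≃ Fin Q) :
    superOp (stripCells C c W) κ
        (∑ p, ∑ q, ∑ σ : Fin 2, if (rectBoxDiagGraph (C * c) W).Adj p q then
          onSite p (siteCreation σ) * (jwString p * jwString q) * onSite q (siteAnnihilation σ) else 0) =
      ∑ b : Fin C, onSite b (superSite κ
        (∑ f, ∑ f', ∑ σ : Fin 2, if (rectBoxDiagGraph c W).Adj f f' then
          onSite f (siteCreation σ) * (jwString f * jwString f') * onSite f' (siteAnnihilation σ) else 0)) +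
      ∑ b : Fin C, ∑ b' : Fin C, if (b : ℕ) + 1 = b' then ∑ d ∈ adjRowPairs W, ∑ σ : Fin 2,
        (onSite b (superSite κ (productOp (interLeftFamily hc d.1 (siteCreation σ * siteParity)))) *
            onSite b' (superSite κ (productOp (interRightFamily hc d.2 (siteAnnihilation σ)))) +
          onSite b (superSite κ (productOp (interLeftFamily hc d.1 (siteParity * siteAnnihilation σ)))) *
            onSite b' (superSite κ (productOp (interRightFamily hc d.2 (siteCreation σ))))) else 0 := by
  simp only [Finset.sum_ite_irrel, Finset.sum_const_zero]
  rw [sum_sum_ite_rectBoxDiagGraph_adj_cells hc, map_add]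
  congr 1
  · rw [map_sum]
    refine Finset.sum_congr rfl fun b _ => ?_
    rw [map_sum, map_sum, onSite_sum_eq]
    refine Finset.sum_congr rfl fun f _ => ?_
    rw [map_sum, map_sum, onSite_sum_eq]
    refine Finset.sum_congr rfl fun f' _ => ?_
    by_cases hff' : (rectBoxDiagGraph c W).Adj f f'
    · rw [if_pos hff', if_pos hff', map_sum, map_sum, onSite_sum_eq]
      refine Finset.sum_congr rfl fun σ _ => ?_
      have hne : f ≠ f' := hff'.ne
      have hne' : (stripCells C c W).symm (b, f) ≠ (stripCells C c W).symm (b, f') := fun h =>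
        hne ((stripCells_symm_eq_iff b b f f').mp h).2
      rw [onSite_mul_jwString_mul_jwString_mul_onSite hne', onSite_mul_jwString_mul_jwString_mul_onSite hne]
      have h := superOp_productOp_jwWordFamily_cell (stripCells C c W) κ b (cellEmb C c W b) (fun _ => rfl)
        (ordConnected_range_cellEmb b) f f' (siteCreation σ) (siteAnnihilation σ)
      simpa only [cellEmb_apply] using h
    · rw [if_neg hff', if_neg hff', map_zero, map_zero, onSite_zero_eq]
  · rw [map_sum]
    refine Finset.sum_congr rfl fun b _ => ?_
    rw [map_sum]
    refine Finset.sum_congr rfl fun b' _ => ?_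
    by_cases hbb' : (b : ℕ) + 1 = b'
    · rw [if_pos hbb', if_pos hbb', sum_adjRowPairs_eq, map_sum]
      refine Finset.sum_congr rfl fun y₀ _ => ?_
      rw [map_sum]
      refine Finset.sum_congr rfl fun y₁ _ => ?_
      by_cases hy : lineAdj (y₀ : ℕ) y₁
      · rw [if_pos hy, if_pos hy, map_add, map_sum, map_sum, Finset.sum_add_distrib]
        have hb : b < b' := by rw [Fin.lt_def]; omega
        have hxy := stripCells_symm_lt_of_lt hb (toLex (⟨c - 1, by omega⟩, y₀)) (toLex ((⟨0, hc⟩ : Fin c), y₁))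
        congr 1 <;> refine Finset.sum_congr rfl fun σ _ => ?_
        · rw [onSite_mul_jwString_mul_jwString_mul_onSite hxy.ne,
            superOp_productOp_jwWordFamily_inter₂ hc κ hbb']
        · rw [onSite_mul_jwString_mul_jwString_mul_onSite hxy.ne',
            superOp_productOp_jwWordFamily_inter₂' hc κ hbb']
      · rw [if_neg hy, if_neg hy, map_zero]
    · rw [if_neg hbb', if_neg hbb', map_zero]

/-- **The open `(C·c) × W` `t–t′` Hubbard box in column-major Jordan–Wigner form, blocked into `C` cells of `c`
columns**: the sum of the cells' own `c × W` `t–t′` Hamiltonians (one-cell operators), and, for consecutive cells,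
the horizontal inter-cell hopping words (amplitude `t`) and the diagonal two-row inter-cell hopping words
(amplitude `t′`). Any enumeration `κ` of the cell configurations. -/
theorem superOp_toSpin_hubbardOpenBoxTT'_TT' (hc : 0 < c) (κ : TensorIndex (Fin c ×ₗ Fin W) 4 ≃ Fin Q)
    (t t' U : ℝ) :
    superOp (stripCells C c W) κ (toSpin (hubbardOpenBoxTT' (C * c) W t t' U)) =
      ∑ b : Fin C, onSite b (superSite κ (toSpin (hubbardOpenBoxTT' c W t t' U))) +
      (-(t : ℂ)) • (∑ b : Fin C, ∑ b' : Fin C, if (b : ℕ) + 1 = b' then ∑ y₀ : Fin W, ∑ σ : Fin 2,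
        (onSite b (superSite κ (productOp (interLeftFamily hc y₀ (siteCreation σ * siteParity)))) *
            onSite b' (superSite κ (productOp (interRightFamily hc y₀ (siteAnnihilation σ)))) +
          onSite b (superSite κ (productOp (interLeftFamily hc y₀ (siteParity * siteAnnihilation σ)))) *
            onSite b' (superSite κ (productOp (interRightFamily hc y₀ (siteCreation σ))))) else 0) +
      (-(t' : ℂ)) • ∑ b : Fin C, ∑ b' : Fin C, if (b : ℕ) + 1 = b' then ∑ d ∈ adjRowPairs W, ∑ σ : Fin 2,
        (onSite b (superSite κ (productOp (interLeftFamily hc d.1 (siteCreation σ * siteParity)))) *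
            onSite b' (superSite κ (productOp (interRightFamily hc d.2 (siteAnnihilation σ)))) +
          onSite b (superSite κ (productOp (interLeftFamily hc d.1 (siteParity * siteAnnihilation σ)))) *
            onSite b' (superSite κ (productOp (interRightFamily hc d.2 (siteCreation σ))))) else 0 := by
  rw [toSpin_hubbardOpenBoxTT'_eq_add_diag (C * c) W t t' U, map_add, map_smul,
    superOp_toSpin_hubbardOpenBoxTT' hc κ t U, superOp_hoppingSum_diag hc κ, smul_add,
    toSpin_hubbardOpenBoxTT'_eq_add_diag c W t t' U]
  simp only [map_add, map_smul, onSite_add', onSite_smul', Finset.sum_add_distrib]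
  rw [← Finset.smul_sum]
  abel

/-! ### The cell bond matrix of the `t–t′` strip and the `bondSum` form -/

/-- **The diagonal inter-cell coupling** of the strip as a matrix on (cell) ⊗ (cell):
`-t′ Σ_{(y₀,y₁) adjacent, σ} (L_{y₀σ} ⊗ R_{y₁σ} + L'_{y₀σ} ⊗ R'_{y₁σ})` with the half-words of `interLeftFamily` /
`interRightFamily` read through `superSite κ` (the `2(W−1)` diagonal bonds between consecutive cells). -/
def interCellDiagMatrix (κ : TensorIndex (Fin c ×ₗ Fin W) 4 ≃ Fin Q) (hc : 0 < c) (t' : ℝ) :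
    Matrix (Fin Q × Fin Q) (Fin Q × Fin Q) ℂ :=
  -(t' : ℂ) • ∑ d ∈ adjRowPairs W, ∑ σ : Fin 2,
    (superSite κ (productOp (interLeftFamily hc d.1 (siteCreation σ * siteParity))) ⊗ₖ
        superSite κ (productOp (interRightFamily hc d.2 (siteAnnihilation σ))) +
      superSite κ (productOp (interLeftFamily hc d.1 (siteParity * siteAnnihilation σ))) ⊗ₖ
        superSite κ (productOp (interRightFamily hc d.2 (siteCreation σ))))

/-- **The cell bond matrix `hh` of the `t–t′` strip**: the intra-cell energy of the LEFT cell (its horizontal AND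
diagonal bonds and its on-site term) plus the horizontal and the diagonal inter-cell couplings. -/
def stripCellBondMatrixTT' (κ : TensorIndex (Fin c ×ₗ Fin W) 4 ≃ Fin Q) (hc : 0 < c) (t t' U : ℝ) :
    Matrix (Fin Q × Fin Q) (Fin Q × Fin Q) ℂ :=
  superSite κ (toSpin (hubbardOpenBoxTT' c W t t' U)) ⊗ₖ (1 : Matrix (Fin Q) (Fin Q) ℂ) +
    interCellMatrix κ hc t + interCellDiagMatrix κ hc t'

/-- At `t′ = 0` the diagonal coupling vanishes. -/
theorem interCellDiagMatrix_tPrime_zero (κ : TensorIndex (Fin c ×ₗ Fin W) 4 ≃ Fin Q) (hc : 0 < c) :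
    interCellDiagMatrix κ hc 0 = 0 := by
  rw [interCellDiagMatrix, Complex.ofReal_zero, neg_zero, zero_smul]

/-- **Sanity: at `t′ = 0` the `t–t′` cell bond matrix IS the landed `stripCellBondMatrix κ hc t U`.** -/
theorem stripCellBondMatrixTT'_tPrime_zero (κ : TensorIndex (Fin c ×ₗ Fin W) 4 ≃ Fin Q) (hc : 0 < c)
    (t U : ℝ) : stripCellBondMatrixTT' κ hc t 0 U = stripCellBondMatrix κ hc t U := by
  rw [stripCellBondMatrixTT', interCellDiagMatrix_tPrime_zero, add_zero, stripCellBondMatrix]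

/-- `bondSum n 0 = 0`. -/
theorem bondSum_zero (n : ℕ) :
    (bondSum n (0 : Matrix (Fin Q × Fin Q) (Fin Q × Fin Q) ℂ) : Op (Fin (n + 2)) Q) = 0 := by
  simpa only [zero_smul] using bondSum_smul n (0 : ℂ) (0 : Matrix (Fin Q × Fin Q) (Fin Q × Fin Q) ℂ)

/-- The bond sum of the diagonal inter-cell coupling over the `n + 1` bonds of the cell chain. -/
theorem bondSum_interCellDiagMatrix (n : ℕ) (κ : TensorIndex (Fin c ×ₗ Fin W) 4 ≃ Fin Q) (hc : 0 < c)
    (t' : ℝ) :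
    (bondSum n (interCellDiagMatrix κ hc t') : Op (Fin (n + 2)) Q) =
      -(t' : ℂ) • ∑ j : Fin (n + 1), ∑ d ∈ adjRowPairs W, ∑ σ : Fin 2,
        (onSite (⟨j, by omega⟩ : Fin (n + 2))
              (superSite κ (productOp (interLeftFamily hc d.1 (siteCreation σ * siteParity)))) *
            onSite (⟨j + 1, by omega⟩ : Fin (n + 2))
              (superSite κ (productOp (interRightFamily hc d.2 (siteAnnihilation σ)))) +
          onSite (⟨j, by omega⟩ : Fin (n + 2))
              (superSite κ (productOp (interLeftFamily hc d.1 (siteParity * siteAnnihilation σ)))) *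
            onSite (⟨j + 1, by omega⟩ : Fin (n + 2))
              (superSite κ (productOp (interRightFamily hc d.2 (siteCreation σ))))) := by
  rw [interCellDiagMatrix, bondSum_smul, bondSum_sum]
  congr 1
  simp only [bondSum_sum, bondSum_add, bondSum_kronecker, Finset.sum_add_distrib]
  congr 1 <;> exact (Finset.sum_congr rfl fun d _ => Finset.sum_comm).trans Finset.sum_comm

/-- **The `t–t′` strip as a chain of cells with the bond matrix `hh`** (`n + 2` cells): the blocked Hamiltonian is the
bond sum of `stripCellBondMatrixTT'` plus the intra-cell energy of the LAST cell (not covered by a bond). -/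
theorem superOp_toSpin_hubbardOpenBoxTT'_eq_bondSum_TT' (n : ℕ) (hc : 0 < c)
    (κ : TensorIndex (Fin c ×ₗ Fin W) 4 ≃ Fin Q) (t t' U : ℝ) :
    superOp (stripCells (n + 2) c W) κ (toSpin (hubbardOpenBoxTT' ((n + 2) * c) W t t' U)) =
      bondSum n (stripCellBondMatrixTT' κ hc t t' U) +
        onSite (Fin.last (n + 1)) (superSite κ (toSpin (hubbardOpenBoxTT' c W t t' U))) := by
  rw [superOp_toSpin_hubbardOpenBoxTT'_TT' hc, stripCellBondMatrixTT', bondSum_add, bondSum_add, bondSum_kronecker,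
    bondSum_interCellMatrix, bondSum_interCellDiagMatrix, sum_sum_ite_val_succ_eq, sum_sum_ite_val_succ_eq,
    Fin.sum_univ_castSucc]
  simp only [onSite_one', mul_one]
  have hcast : ∀ j : Fin (n + 1), (Fin.castSucc j : Fin (n + 2)) = ⟨j, by omega⟩ := fun j => rfl
  simp only [hcast]
  abel

end Hamiltonian

end Summit.Ventures.CertifiedManyBodySolver.Upper

end
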